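import Mathlib.MeasureTheory.Constructions.Cylinders
import Literature.MathematicalPhysics.KineticTheory.InfiniteChainInvariantStates
import Literature.Probability.LatticeModels.MarkovChainMeasure
import HarnessLib

/-!
# Measures with transfer-kernel window densities are shift invariant

Topic `Literature/MathematicalPhysics/KineticTheory`; theorems only (no definitions, no named
facts). Companion of `Literature.Probability.LatticeModels.MarkovWindowDensity` /
`MarkovChainMeasure` (the two-sided stationary Markov chain of a transfer kernel: a probability
measure `μ` on `ℤ → ℝ × ℝ` with `∫ Φ dμ = (∫⋯∫⁻_{a,…,a+n} Φ · D a n)(η)` for observables `Φ` of the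
window `{a, …, a+n}`) and of `InfiniteChainInvariantStates.lean` (`shift`, `IsShiftInvariant`).

Since the window densities are translation covariant, `D (a+1) n σ = D a n (shift σ)`, the window
formula transports under the spatial shift `(shift σ)_x = σ_{x+1}` (Mathlib `lmarginal_image` for
the injection `x ↦ x + 1`), so `μ ∘ shift⁻¹` and `μ` agree on cylinder events and hence coincide:
**the Markov-chain state is translation invariant** (stationarity of the two-sided chain;
Georgii 2011, Thm 10.25 / §11.1; Cassandro–Olivieri–Pellegrinotti–Presutti 1978, §2).

* `measurable_shift` — the shift is measurable;
* `windowDensity_shift` — `D (a+1) n σ = D a n (shift σ)`;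
* `isShiftInvariant_of_windowDensity` — **the theorem**.

[cite: Georgii2011, Thm 10.25 and §11.1]
-/

noncomputable section

open MeasureTheory Set Function Finset Literature.Probability.LatticeModels
open scoped ENNReal

namespace Literature.MathematicalPhysics.KineticTheory.HeatConduction

/-- The spatial shift of configurations is measurable. [folklore] -/
theorem measurable_shift : Measurable (shift : ChainConfig → ChainConfig) :=
  measurable_pi_lambda _ fun x => measurable_pi_apply (x + 1)

/-- `shift σ` is Mathlib's dependent pre-composition `σ ∘' (· + 1)`. [folklore] -/
theorem shift_eq_dcomp (σ : ChainConfig) : shift σ = (σ ∘' fun x : ℤ => x + 1) := rfl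

/-- **Translation covariance of the window densities**: `D (a+1) n σ = D a n (shift σ)`. [folklore] -/
theorem windowDensity_shift {k : ℝ × ℝ → ℝ × ℝ → ℝ≥0∞} {φ w : ℝ × ℝ → ℝ≥0∞} {L : ℝ≥0∞}
    {D : ℤ → ℕ → ChainConfig → ℝ≥0∞}
    (hD : ∀ a n σ, D a n σ = φ (σ a) * φ (σ (a + n)) *
      (∏ j ∈ Finset.range n, k (σ (a + j)) (σ (a + j + 1)) * L⁻¹) *
      ∏ j ∈ Finset.range (n + 1), w (σ (a + j)))
    (a : ℤ) (n : ℕ) (σ : ChainConfig) : D (a + 1) n σ = D a n (shift σ) := by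
  rw [hD, hD]
  simp only [shift]
  have e1 : a + 1 + (n : ℤ) = a + n + 1 := by ring
  have e2 : ∀ j : ℕ, a + 1 + (j : ℤ) = a + j + 1 := fun j => by ring
  rw [e1]
  simp only [e2]

/-- **Measures with transfer-kernel window densities are shift invariant.** If a probability
measure `μ` on `ℤ → ℝ × ℝ` integrates every observable of a window `{a, …, a+n}` to
`(∫⋯∫⁻ Φ · D a n)(η)` with the (translation covariant) window densities `D` of
`MarkovWindowDensity`, then `μ ∘ shift⁻¹ = μ` (`IsShiftInvariant μ`).
[cite: Georgii2011, Thm 10.25 and §11.1] -/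
theorem isShiftInvariant_of_windowDensity {k : ℝ × ℝ → ℝ × ℝ → ℝ≥0∞} {φ w : ℝ × ℝ → ℝ≥0∞}
    {L : ℝ≥0∞} {D : ℤ → ℕ → ChainConfig → ℝ≥0∞}
    (hk : Measurable (uncurry k)) (hφ : Measurable φ) (hw : Measurable w)
    (hD : ∀ a n σ, D a n σ = φ (σ a) * φ (σ (a + n)) *
      (∏ j ∈ Finset.range n, k (σ (a + j)) (σ (a + j + 1)) * L⁻¹) *
      ∏ j ∈ Finset.range (n + 1), w (σ (a + j)))
    {μ : Measure ChainConfig} [IsProbabilityMeasure μ]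
    (hμ : ∀ (a : ℤ) (n : ℕ) (Φ : ChainConfig → ℝ≥0∞), Measurable Φ →
      DependsOn Φ (↑(Finset.Icc a (a + n)) : Set ℤ) → ∀ η : ChainConfig,
        ∫⁻ σ, Φ σ ∂μ = (∫⋯∫⁻_Finset.Icc a (a + n), (fun σ => Φ σ * D a n σ)
          ∂fun _ : ℤ => (volume : Measure (ℝ × ℝ))) η) :
    IsShiftInvariant μ := by
  classical
  unfold IsShiftInvariant
  haveI : IsProbabilityMeasure (μ.map shift) :=
    Measure.isProbabilityMeasure_map measurable_shift.aemeasurable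
  -- agreement on cylinders
  have hcyl : ∀ s ∈ measurableCylinders (fun _ : ℤ => ℝ × ℝ), (μ.map shift) s = μ s := by
    intro s hs
    obtain ⟨I, C, hC, rfl⟩ := (mem_measurableCylinders _).1 hs
    have hA : MeasurableSet (cylinder I C) := MeasurableSet.cylinder (α := fun _ : ℤ => ℝ × ℝ) I hC
    rw [Measure.map_apply measurable_shift hA, ← lintegral_indicator_one (measurable_shift hA),
      ← lintegral_indicator_one hA]
    -- a window `{a, …, a+n}` containing `I`
    set N : ℕ := I.sup Int.natAbs with hN
    set a : ℤ := -(N : ℤ) with ha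
    set n : ℕ := 2 * N with hn
    have hI : I ⊆ Finset.Icc a (a + n) := by
      have := subset_Icc_sup_natAbs I
      rw [ha, hn]; exact this
    -- the indicator of `shift ⁻¹' A` is `𝟙_A ∘ shift`, an observable of the window `{a+1, …, a+1+n}`
    have hind : ∀ σ, (shift ⁻¹' cylinder I C).indicator (1 : ChainConfig → ℝ≥0∞) σ =
        (cylinder I C).indicator (1 : ChainConfig → ℝ≥0∞) (shift σ) := fun σ => by
      by_cases h : shift σ ∈ cylinder I C
      · rw [indicator_of_mem h, indicator_of_mem (Set.mem_preimage.2 h)]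
        rfl
      · rw [indicator_of_notMem h, indicator_of_notMem fun h' => h (Set.mem_preimage.1 h')]
    have hAdep : DependsOn ((cylinder I C).indicator (1 : ChainConfig → ℝ≥0∞)) (↑I : Set ℤ) :=
      fun x y hxy => dependsOn_cylinder_indicator_const C (1 : ℝ≥0∞) hxy
    have hdep : DependsOn (fun σ => (cylinder I C).indicator (1 : ChainConfig → ℝ≥0∞) (shift σ))
        (↑(Finset.Icc (a + 1) (a + 1 + n)) : Set ℤ) := by
      intro x y hxy
      refine hAdep fun i hi => ?_
      have hi' : i ∈ Finset.Icc a (a + n) := hI (Finset.mem_coe.1 hi)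
      simp only [Finset.mem_Icc] at hi'
      simp only [shift]
      exact hxy (i + 1) (Finset.mem_coe.2 (Finset.mem_Icc.2 ⟨by omega, by omega⟩))
    have hmeasA : Measurable ((cylinder I C).indicator (1 : ChainConfig → ℝ≥0∞)) :=
      measurable_one.indicator hA
    have hmeasΦ : Measurable fun σ => (cylinder I C).indicator (1 : ChainConfig → ℝ≥0∞) (shift σ) :=
      hmeasA.comp measurable_shift
    set η₀ : ChainConfig := fun _ => (0, 0) with hη₀
    calc ∫⁻ σ, (shift ⁻¹' cylinder I C).indicator 1 σ ∂μ
        = ∫⁻ σ, (cylinder I C).indicator (1 : ChainConfig → ℝ≥0∞) (shift σ) ∂μ :=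
          lintegral_congr fun σ => hind σ
      _ = (∫⋯∫⁻_Finset.Icc (a + 1) (a + 1 + n),
            (fun σ => (cylinder I C).indicator (1 : ChainConfig → ℝ≥0∞) (shift σ) * D (a + 1) n σ)
            ∂fun _ : ℤ => (volume : Measure (ℝ × ℝ))) η₀ := hμ (a + 1) n _ hmeasΦ hdep η₀
      _ = (∫⋯∫⁻_(Finset.Icc a (a + n)).image (fun x : ℤ => x + 1),
            ((fun σ => (cylinder I C).indicator (1 : ChainConfig → ℝ≥0∞) σ * D a n σ) ∘
              (· ∘' fun x : ℤ => x + 1))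
            ∂fun _ : ℤ => (volume : Measure (ℝ × ℝ))) η₀ := by
          have himg : (Finset.Icc a (a + n)).image (fun x : ℤ => x + 1) = Finset.Icc (a + 1) (a + 1 + n) := by
            ext x
            simp only [Finset.mem_image, Finset.mem_Icc]
            constructor
            · rintro ⟨y, hy, rfl⟩; omega
            · intro hx; exact ⟨x - 1, by omega, by ring⟩
          rw [himg]
          congr 1
          funext σ
          simp only [Function.comp_apply, ← shift_eq_dcomp, windowDensity_shift hD a n σ]
      _ = (∫⋯∫⁻_Finset.Icc a (a + n),
            (fun σ => (cylinder I C).indicator (1 : ChainConfig → ℝ≥0∞) σ * D a n σ)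
            ∂fun _ : ℤ => (volume : Measure (ℝ × ℝ))) (η₀ ∘' fun x : ℤ => x + 1) := by
          have hF : Measurable fun σ : ChainConfig =>
              (cylinder I C).indicator (1 : ChainConfig → ℝ≥0∞) σ * D a n σ :=
            hmeasA.mul (measurable_D hk hφ hw hD a n)
          exact lmarginal_image (μ := fun _ : ℤ => (volume : Measure (ℝ × ℝ)))
            (e := fun x : ℤ => x + 1) (fun x y h => by simpa using h) (Finset.Icc a (a + n))
            (f := fun σ : ChainConfig => (cylinder I C).indicator (1 : ChainConfig → ℝ≥0∞) σ * D a n σ)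
            hF η₀
      _ = ∫⁻ σ, (cylinder I C).indicator 1 σ ∂μ :=
          (hμ a n _ hmeasA (hAdep.mono fun i hi => Finset.mem_coe.2 (hI (Finset.mem_coe.1 hi))) _).symm
  have huniv : (μ.map shift) univ = μ univ := by
    rw [measure_univ, measure_univ]
  exact ext_of_generate_finite (measurableCylinders fun _ : ℤ => ℝ × ℝ)
    generateFrom_measurableCylinders.symm isPiSystem_measurableCylinders hcyl huniv

end Literature.MathematicalPhysics.KineticTheory.HeatConduction

end
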